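import Mathlib
import HarnessLib
import Summits.HubbardSuperconductivity.HubbardSuperconductivity.Theorems.KLProgrammeKLRegimeTwoVolumeSymInterp
import Summits.HubbardSuperconductivity.HubbardSuperconductivity.Theorems.KLProgrammeKLRegimeSplitTwoLegMomentsFromPosition
import Summits.HubbardSuperconductivity.HubbardSuperconductivity.Theorems.KLProgrammeKLRegimeSplitTwoLegCounterVertex
import Summits.HubbardSuperconductivity.HubbardSuperconductivity.Theorems.KLProgrammeKLRegimeSplitTwoLegCoreTDTube
import Summits.HubbardSuperconductivity.HubbardSuperconductivity.Theorems.KLProgrammeKLRegimeEngineFrameShiftMomentReading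

/-!
# The two-volume common-point defect (D) of the scale-`n` readings from the PINNED DEFECT OF THE DUAL-LATTICE TWO-LEG KERNELS
# (β′ lane, read-out half; cell gate-hubbard-kl, seat hubbard-kl-k3c5-p2 g7)

The one-step split door `EngineV8.spLeg_step_of_pointDefect_hist` (…EngineTwoLegSpLegStepSplit) reduces row C2 (`hsp`) of the two-leg stubs at scale
`n` to (R) a reading gradient and (D) the two-volume defect of the two readings at ONE continuum point `q`:
`|S_c(q) − S_f(q)|`, `S_L = symInterp L (klLocSelfEnergyRe L M … K_L n)`, coarse `L_c ∣ L_f` fine, the frames `K_c ≠ K_f` INSIDE the two objects.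
This file supplies (D) from Grassmann data in the DUAL-LATTICE currency of a multiscale tower's two-leg output (r2d-p1's
`stub_twoLeg_step_of_dualMoments_GQ`, p3's `…TwoLegMomentsFromPosition/OffDiag`): the unsectorised position-space two-leg kernel
`W_σ(G) = sectorisedKernel L M β (trivialMultiplier L M) G 2 ((0,σ,+),(0,σ,−))` on `SpaceTimeIdx L M`, for `G_L := 𝒱_L⁽ⁿ⁾[K_L] − 𝒩_{K_L}`.

* §1 (one volume, generic `G`, EXACT): the cosine coefficient of `k⃗ ↦ Re Σ_G((ω,k⃗),σ)` at `y` is `(βL²/|Λ|²)·Re[Q(y) + Q(−y)]` with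
  `Q(y) = Σ_{x : x⃗₁ = x⃗₀ + y} W(x)·e^{iω(t₀ − t₁)}` (`torusCosCoeff_re_selfEnergy_eq`, from p1b's `card_sq_mul_sum_kernel_two_mul_torusChar`), and
  `Q(y) = Σ_{x₀} R(x₀; y)` with the PHASE-WEIGHTED ROW `R(x₀; y) = Σ_{t₁} W(x₀, (t₁, x⃗₀ + y))·e^{iω(t₀ − t₁)}` (`offsetSum_eq_sum_rows`); under
  base-point independence of the rows (`hrow` — momentum conservation of `G`; a hypothesis here) `c(y) = ε·Re[R(x₀;y) + R(x₀;−y)]`,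
  `ε = imagTimeWeight β M` (`torusCosCoeff_re_selfEnergy_eq_row_of_rowInvariant`);
* §2 (two volumes `L_f = b·L_c`, same `M`, generic `G_c, G_f` with `hrow`): `|I_c[Re Σ_c(ω,·,σ)](q) − I_f[Re Σ_f(ω,·,σ)](q)|
  ≤ ε·(Σ_ȳ (|R_c(o_c;ȳ) − R_f(o_f;ȳ↑)| + |R_c(o_c;−ȳ) − R_f(o_f;−ȳ↑)|) + Σ_{y ≠ (red y)↑} (|R_f(o_f;y)| + |R_f(o_f;−y)|))` at ANY pins `o_c, o_f` and any
  continuum `q` (`ȳ↑ = proj (cRep ȳ)` the centred lift; `…TwoVolumeSymInterp.abs_eval_symInterp_sub_le_pinned_add_far`); then the `±ω₀`/spin average;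
* §3 (model, scale `n`, frames `K_c, K_f` of degree `≤ L/2`): `S_L = K_L + I_L[loc(𝒱_L⁽ⁿ⁾[K_L] − 𝒩_{K_L})]` (`klLocSelfEnergyRe_sub_frame_eq_locRe`,
  `evalM_symInterp_eq_sep_add_frame`), hence **`abs_symInterp_locRe_sub_le_frame_add_dualDefect`**:
  `|S_c(q) − S_f(q)| ≤ |K_c(q) − K_f(q)| + ε·(Ddef + Dfar)` — the `hD` input of the split door, with the coefficient-`1` frame term explicit.

Proofs only; no definitions; nothing about the model is asserted beyond the displayed identities/inequalities.  References: BGM 2006 §2.1 (2.4)–(2.5),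
§2.3 (2.17), §2.4 (2.36) [cite: BenfattoGiulianiMastropietro2006].
-/

noncomputable section

namespace Summit.HubbardSuperconductivity.HubbardSuperconductivity.Theorems.TwoVolumeDefect

set_option linter.dupNamespace false -- summit = problem name (single-conjunct summit), D-0017

open Finset Complex Literature.MathematicalPhysics.QuantumLattice Literature.Probability.LatticeModels GrassmannAlgebra
open Summit.HubbardSuperconductivity.HubbardSuperconductivity.Theorems.KLRegimeSplit
open Summit.HubbardSuperconductivity.HubbardSuperconductivity.Theorems.KLProgrammeLegKernels
open Summit.HubbardSuperconductivity.HubbardSuperconductivity.Theorems.TwoLegFourier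
open scoped ComplexConjugate

/-! ## §1 One volume: the cosine coefficients of `Re Σ_G((ω,·),σ)` as phase-weighted rows of the dual-lattice kernel -/

section OneVolume

variable {L M : ℕ} [NeZero L] [NeZero M]

omit [NeZero M] in
/-- **The offset-constrained tuple sum is the sum of the rows over the base point**: for any `f`,
`Σ_{x : x⃗₀ − x⃗₁ + y = 0} f x = Σ_{x₀} Σ_{t₁} f (x₀, (t₁, x⃗₀ + y))`. -/
theorem offsetSum_eq_sum_rows (f : (Fin 2 → SpaceTimeIdx L M) → ℂ) (y : TorusSite 2 L) :
    (∑ x : Fin 2 → SpaceTimeIdx L M, if (x 0).2 - (x 1).2 + y = 0 then f x else 0) =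
      ∑ x₀ : SpaceTimeIdx L M, ∑ t₁ : ImagTimeIdx M, f ![x₀, (t₁, x₀.2 + y)] := by
  classical
  rw [← Finset.sum_filter]
  have hcond : ∀ x : Fin 2 → SpaceTimeIdx L M, (x 0).2 - (x 1).2 + y = 0 ↔ (x 1).2 = (x 0).2 + y := fun x => by
    rw [sub_add_eq_add_sub, sub_eq_zero, eq_comm]
  rw [← Finset.sum_fiberwise_of_maps_to (s := univ.filter fun x : Fin 2 → SpaceTimeIdx L M => (x 0).2 - (x 1).2 + y = 0)
    (t := (univ : Finset (SpaceTimeIdx L M))) (g := fun x => x 0) (fun _ _ => mem_univ _)]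
  refine sum_congr rfl fun x₀ _ => ?_
  rw [Finset.filter_filter]
  -- the tuples of the fibre are `![x₀, (t₁, x⃗₀ + y)]`
  have hj : ∀ x ∈ (univ : Finset (Fin 2 → SpaceTimeIdx L M)).filter
      (fun x => (x 0).2 - (x 1).2 + y = 0 ∧ x 0 = x₀), ![x₀, ((x 1).1, x₀.2 + y)] = x := by
    intro x hx
    obtain ⟨hc, h0⟩ := (mem_filter.1 hx).2
    have h1 : (x 1).2 = x₀.2 + y := by rw [(hcond x).1 hc, h0]
    funext i
    fin_cases i
    · simp [h0]
    · simp only [Fin.mk_one, Matrix.cons_val_one, Matrix.cons_val_zero]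
      rw [← h1]
  refine Finset.sum_nbij' (fun x => (x 1).1) (fun t₁ => ![x₀, (t₁, x₀.2 + y)]) (fun _ _ => mem_univ _) (fun t₁ _ => ?_)
    (fun x hx => hj x hx) (fun t₁ _ => ?_) (fun x hx => ?_)
  · exact mem_filter.2 ⟨mem_univ _, (hcond _).2 (by simp), by simp⟩
  · simp
  · rw [hj x hx]

omit [NeZero M] in
/-- **THE COSINE COEFFICIENTS OF `k⃗ ↦ Re Σ_G((ω,k⃗),σ)` ARE PHASE-WEIGHTED OFFSET SUMS OF THE DUAL-LATTICE KERNEL** (exact, `β ≠ 0`):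
`torusCosCoeff L (Re Σ_G((ω,·),σ)) y = (βL²/|Λ|²)·Re[Q(y) + Q(−y)]`, `Q(y) = Σ_{x₀} Σ_{t₁} W(x₀,(t₁,x⃗₀+y))·e^{iω(t₀−t₁)}`,
`W = sectorisedKernel β (trivialMultiplier) G 2 ((0,σ,+),(0,σ,−))`, `|Λ| = |SpaceTimeIdx L M|`. -/
theorem torusCosCoeff_re_selfEnergy_eq {β : ℝ} (hβ : β ≠ 0) (G : HubbardGrassmann L M) (n : MatsubaraIdx M) (σ : Fin 2) (y : TorusSite 2 L) :
    torusCosCoeff L (fun k => (selfEnergy L M β G (n, k) σ).re) y =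
      β * (L : ℝ) ^ 2 / (Fintype.card (SpaceTimeIdx L M) : ℝ) ^ 2 *
        ((∑ x₀ : SpaceTimeIdx L M, ∑ t₁ : ImagTimeIdx M,
            sectorisedKernel L M β (trivialMultiplier L M) G 2 (![((0, σ), 0), ((0, σ), 1)] : Fin 2 → SectorLeg 1) ![x₀, (t₁, x₀.2 + y)] *
              Complex.exp (((matsubaraFreq β M n * (imagTime β M x₀.1 - imagTime β M t₁) : ℝ) : ℂ) * I)) +
          (∑ x₀ : SpaceTimeIdx L M, ∑ t₁ : ImagTimeIdx M,
            sectorisedKernel L M β (trivialMultiplier L M) G 2 (![((0, σ), 0), ((0, σ), 1)] : Fin 2 → SectorLeg 1) ![x₀, (t₁, x₀.2 + -y)] *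
              Complex.exp (((matsubaraFreq β M n * (imagTime β M x₀.1 - imagTime β M t₁) : ℝ) : ℂ) * I))).re := by
  set W := sectorisedKernel L M β (trivialMultiplier L M) G 2 (![((0, σ), 0), ((0, σ), 1)] : Fin 2 → SectorLeg 1) with hW
  set P : ℝ := (Fintype.card (SpaceTimeIdx L M) : ℝ) with hP
  set F : TorusSite 2 L → ℂ := fun k => kernel ℂ G 2 ![(((n, k), σ), 0), (((n, k), σ), 1)] with hF
  have hL : (0 : ℝ) < (L : ℝ) ^ 2 := by have := NeZero.ne L; positivity
  have hPpos : 0 < P := by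
    rw [hP]; exact_mod_cast (Fintype.card_pos_iff.2 ⟨(n, y)⟩ : 0 < Fintype.card (SpaceTimeIdx L M))
  -- the coefficient as two character sums (p1b's computation)
  have hcoeff : torusCosCoeff L (fun k => (selfEnergy L M β G (n, k) σ).re) y =
      ((L : ℝ) ^ 2)⁻¹ * (2 * (β * (L : ℝ) ^ 2)) *
        (((∑ k, F k * torusChar k y).re + (∑ k, F k * torusChar k (-y)).re) / 2) := by
    unfold torusCosCoeff
    rw [mul_assoc]
    congr 1
    have hterm : ∀ k : TorusSite 2 L, (selfEnergy L M β G (n, k) σ).re *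
        Real.cos (∑ i, latticeMomentum L k i * ((y i).valMinAbs : ℝ)) =
        2 * (β * (L : ℝ) ^ 2) * (((F k * torusChar k y).re + (F k * torusChar k (-y)).re) / 2) := by
      intro k
      rw [cos_latticeMomentum_valMinAbs_eq_re, selfEnergy_eq_vertexFn, Literature.Analysis.Complex.PowerSum.re_mul_re_eq,
        ← torusChar_neg_right]
      simp only [hF, mul_assoc, Complex.re_ofReal_mul]
      ring
    simp_rw [hterm]
    rw [← mul_sum, Complex.re_sum, Complex.re_sum, ← sum_div, ← sum_add_distrib]
  -- each character sum is the offset sum (p1b), reindexed as rows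
  have hPc : (Fintype.card (SpaceTimeIdx L M) : ℂ) ≠ 0 := by
    rw [Nat.cast_ne_zero]; exact (Fintype.card_pos_iff.2 ⟨(n, y)⟩).ne'
  have hchar : ∀ z : TorusSite 2 L, (∑ k, F k * torusChar k z).re =
      (L : ℝ) ^ 2 / P ^ 2 * (∑ x₀ : SpaceTimeIdx L M, ∑ t₁ : ImagTimeIdx M, W ![x₀, (t₁, x₀.2 + z)] *
        Complex.exp (((matsubaraFreq β M n * (imagTime β M x₀.1 - imagTime β M t₁) : ℝ) : ℂ) * I)).re := by
    intro z
    have h := card_sq_mul_sum_kernel_two_mul_torusChar hβ G n σ z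
    rw [← hW, offsetSum_eq_sum_rows] at h
    simp only [Matrix.cons_val_zero, Matrix.cons_val_one] at h
    -- solve for the character sum
    have h' : ∑ k, F k * torusChar k z = ((L : ℂ) ^ 2 / (Fintype.card (SpaceTimeIdx L M) : ℂ) ^ 2) *
        ∑ x₀ : SpaceTimeIdx L M, ∑ t₁ : ImagTimeIdx M, W ![x₀, (t₁, x₀.2 + z)] *
          Complex.exp (((matsubaraFreq β M n * (imagTime β M x₀.1 - imagTime β M t₁) : ℝ) : ℂ) * I) := by
      rw [div_mul_eq_mul_div, eq_div_iff (pow_ne_zero 2 hPc), mul_comm, hF]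
      exact h
    rw [h']
    have hcast : ((L : ℂ) ^ 2 / (Fintype.card (SpaceTimeIdx L M) : ℂ) ^ 2) = (((L : ℝ) ^ 2 / P ^ 2 : ℝ) : ℂ) := by
      rw [hP]; push_cast; rfl
    rw [hcast, Complex.re_ofReal_mul]
  have key : ∀ a1 a2 : ℝ, ((L : ℝ) ^ 2)⁻¹ * (2 * (β * (L : ℝ) ^ 2)) * (((L : ℝ) ^ 2 / P ^ 2 * a1 + (L : ℝ) ^ 2 / P ^ 2 * a2) / 2) =
      β * (L : ℝ) ^ 2 / P ^ 2 * (a1 + a2) := by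
    intro a1 a2
    field_simp
  rw [hcoeff, hchar y, hchar (-y), key, ← Complex.add_re]

/-- **Under base-point independence of the phase-weighted rows** (`hrow`, e.g. from momentum conservation of `G`): for ANY pin `o`,
`torusCosCoeff L (Re Σ_G((ω,·),σ)) y = ε·Re[R(o; y) + R(o; −y)]`, `ε = imagTimeWeight β M`, `R(o;y) = Σ_{t₁} W(o,(t₁,o⃗+y))·e^{iω(t_o − t₁)}`. -/
theorem torusCosCoeff_re_selfEnergy_eq_row_of_rowInvariant {β : ℝ} (hβ : β ≠ 0) (G : HubbardGrassmann L M) (n : MatsubaraIdx M) (σ : Fin 2)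
    (hrow : ∀ (x₀ x₀' : SpaceTimeIdx L M) (z : TorusSite 2 L),
      (∑ t₁ : ImagTimeIdx M,
        sectorisedKernel L M β (trivialMultiplier L M) G 2 (![((0, σ), 0), ((0, σ), 1)] : Fin 2 → SectorLeg 1) ![x₀, (t₁, x₀.2 + z)] *
          Complex.exp (((matsubaraFreq β M n * (imagTime β M x₀.1 - imagTime β M t₁) : ℝ) : ℂ) * I)) =
      ∑ t₁ : ImagTimeIdx M,
        sectorisedKernel L M β (trivialMultiplier L M) G 2 (![((0, σ), 0), ((0, σ), 1)] : Fin 2 → SectorLeg 1) ![x₀', (t₁, x₀'.2 + z)] *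
          Complex.exp (((matsubaraFreq β M n * (imagTime β M x₀'.1 - imagTime β M t₁) : ℝ) : ℂ) * I))
    (o : SpaceTimeIdx L M) (y : TorusSite 2 L) :
    torusCosCoeff L (fun k => (selfEnergy L M β G (n, k) σ).re) y =
      imagTimeWeight β M *
        ((∑ t₁ : ImagTimeIdx M,
            sectorisedKernel L M β (trivialMultiplier L M) G 2 (![((0, σ), 0), ((0, σ), 1)] : Fin 2 → SectorLeg 1) ![o, (t₁, o.2 + y)] *
              Complex.exp (((matsubaraFreq β M n * (imagTime β M o.1 - imagTime β M t₁) : ℝ) : ℂ) * I)) +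
          (∑ t₁ : ImagTimeIdx M,
            sectorisedKernel L M β (trivialMultiplier L M) G 2 (![((0, σ), 0), ((0, σ), 1)] : Fin 2 → SectorLeg 1) ![o, (t₁, o.2 + -y)] *
              Complex.exp (((matsubaraFreq β M n * (imagTime β M o.1 - imagTime β M t₁) : ℝ) : ℂ) * I))).re := by
  rw [torusCosCoeff_re_selfEnergy_eq hβ G n σ y]
  have hP : (0 : ℝ) < (Fintype.card (SpaceTimeIdx L M) : ℝ) := by
    exact_mod_cast (Fintype.card_pos_iff.2 ⟨(n, y)⟩ : 0 < Fintype.card (SpaceTimeIdx L M))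
  have hconst : ∀ z : TorusSite 2 L, (∑ x₀ : SpaceTimeIdx L M, ∑ t₁ : ImagTimeIdx M,
      sectorisedKernel L M β (trivialMultiplier L M) G 2 (![((0, σ), 0), ((0, σ), 1)] : Fin 2 → SectorLeg 1) ![x₀, (t₁, x₀.2 + z)] *
        Complex.exp (((matsubaraFreq β M n * (imagTime β M x₀.1 - imagTime β M t₁) : ℝ) : ℂ) * I)) =
      (Fintype.card (SpaceTimeIdx L M) : ℂ) * ∑ t₁ : ImagTimeIdx M,
        sectorisedKernel L M β (trivialMultiplier L M) G 2 (![((0, σ), 0), ((0, σ), 1)] : Fin 2 → SectorLeg 1) ![o, (t₁, o.2 + z)] *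
          Complex.exp (((matsubaraFreq β M n * (imagTime β M o.1 - imagTime β M t₁) : ℝ) : ℂ) * I) := by
    intro z
    rw [sum_congr rfl fun x₀ _ => hrow x₀ o z, sum_const, card_univ, nsmul_eq_mul]
  have hre : ∀ w : ℂ, ((Fintype.card (SpaceTimeIdx L M) : ℂ) * w).re = (Fintype.card (SpaceTimeIdx L M) : ℝ) * w.re := fun w => by
    rw [← Complex.ofReal_natCast, Complex.re_ofReal_mul]
  have key : ∀ a : ℝ, β * (L : ℝ) ^ 2 / (Fintype.card (SpaceTimeIdx L M) : ℝ) ^ 2 * ((Fintype.card (SpaceTimeIdx L M) : ℝ) * a) =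
      imagTimeWeight β M * a := by
    intro a
    rw [← imagTimeWeight_mul_card β L M]
    field_simp
  rw [hconst y, hconst (-y), ← mul_add, hre, key]

end OneVolume

/-! ## §2 Two volumes: the common-point symInterp difference from the pinned row defect and the far fine rows -/

section TwoVolumes

variable {Lc Lf b M : ℕ} [NeZero Lc] [NeZero Lf] [NeZero M]

/-- **ONE STRING (`ω`, `σ`), TWO VOLUMES, ONE COMMON POINT**: for `Lf = b·Lc`, the same `M`, `β ≠ 0`, Grassmann elements `G_c`, `G_f` of the two
volumes whose phase-weighted rows are base-point independent (`0 < β`), pins `o_c`, `o_f`, and the data `Ddef` (row defect through the centred lift, both signs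
of the offset) and `Dfar` (fine rows off the lift's image, both signs): at every continuum `q`,
`|I_c[Re Σ_c((ω,·),σ)](q) − I_f[Re Σ_f((ω,·),σ)](q)| ≤ ε·(Ddef + Dfar)`. -/
theorem abs_eval_symInterp_re_selfEnergy_sub_le_dualDefect (hL : Lf = b * Lc) {β : ℝ} (hβ : 0 < β)
    (Gc : HubbardGrassmann Lc M) (Gf : HubbardGrassmann Lf M) (n : MatsubaraIdx M) (σ : Fin 2)
    (hrowc : ∀ (x₀ x₀' : SpaceTimeIdx Lc M) (z : TorusSite 2 Lc),
      (∑ t₁ : ImagTimeIdx M,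
        sectorisedKernel Lc M β (trivialMultiplier Lc M) Gc 2 (![((0, σ), 0), ((0, σ), 1)] : Fin 2 → SectorLeg 1) ![x₀, (t₁, x₀.2 + z)] *
          Complex.exp (((matsubaraFreq β M n * (imagTime β M x₀.1 - imagTime β M t₁) : ℝ) : ℂ) * I)) =
      ∑ t₁ : ImagTimeIdx M,
        sectorisedKernel Lc M β (trivialMultiplier Lc M) Gc 2 (![((0, σ), 0), ((0, σ), 1)] : Fin 2 → SectorLeg 1) ![x₀', (t₁, x₀'.2 + z)] *
          Complex.exp (((matsubaraFreq β M n * (imagTime β M x₀'.1 - imagTime β M t₁) : ℝ) : ℂ) * I))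
    (hrowf : ∀ (x₀ x₀' : SpaceTimeIdx Lf M) (z : TorusSite 2 Lf),
      (∑ t₁ : ImagTimeIdx M,
        sectorisedKernel Lf M β (trivialMultiplier Lf M) Gf 2 (![((0, σ), 0), ((0, σ), 1)] : Fin 2 → SectorLeg 1) ![x₀, (t₁, x₀.2 + z)] *
          Complex.exp (((matsubaraFreq β M n * (imagTime β M x₀.1 - imagTime β M t₁) : ℝ) : ℂ) * I)) =
      ∑ t₁ : ImagTimeIdx M,
        sectorisedKernel Lf M β (trivialMultiplier Lf M) Gf 2 (![((0, σ), 0), ((0, σ), 1)] : Fin 2 → SectorLeg 1) ![x₀', (t₁, x₀'.2 + z)] *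
          Complex.exp (((matsubaraFreq β M n * (imagTime β M x₀'.1 - imagTime β M t₁) : ℝ) : ℂ) * I))
    (oc : SpaceTimeIdx Lc M) (of : SpaceTimeIdx Lf M) {Ddef Dfar : ℝ}
    (hdef : ∑ ybar : TorusSite 2 Lc,
      (‖(∑ t₁ : ImagTimeIdx M,
          sectorisedKernel Lc M β (trivialMultiplier Lc M) Gc 2 (![((0, σ), 0), ((0, σ), 1)] : Fin 2 → SectorLeg 1) ![oc, (t₁, oc.2 + ybar)] *
            Complex.exp (((matsubaraFreq β M n * (imagTime β M oc.1 - imagTime β M t₁) : ℝ) : ℂ) * I)) -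
        (∑ t₁ : ImagTimeIdx M,
          sectorisedKernel Lf M β (trivialMultiplier Lf M) Gf 2 (![((0, σ), 0), ((0, σ), 1)] : Fin 2 → SectorLeg 1)
              ![of, (t₁, of.2 + Torus.proj Lf (Torus.cRep ybar))] *
            Complex.exp (((matsubaraFreq β M n * (imagTime β M of.1 - imagTime β M t₁) : ℝ) : ℂ) * I))‖ +
      ‖(∑ t₁ : ImagTimeIdx M,
          sectorisedKernel Lc M β (trivialMultiplier Lc M) Gc 2 (![((0, σ), 0), ((0, σ), 1)] : Fin 2 → SectorLeg 1) ![oc, (t₁, oc.2 + -ybar)] *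
            Complex.exp (((matsubaraFreq β M n * (imagTime β M oc.1 - imagTime β M t₁) : ℝ) : ℂ) * I)) -
        (∑ t₁ : ImagTimeIdx M,
          sectorisedKernel Lf M β (trivialMultiplier Lf M) Gf 2 (![((0, σ), 0), ((0, σ), 1)] : Fin 2 → SectorLeg 1)
              ![of, (t₁, of.2 + -Torus.proj Lf (Torus.cRep ybar))] *
            Complex.exp (((matsubaraFreq β M n * (imagTime β M of.1 - imagTime β M t₁) : ℝ) : ℂ) * I))‖) ≤ Ddef)
    (hfar : ∑ y ∈ univ.filter (fun y : TorusSite 2 Lf => Torus.proj Lf (Torus.cRep (fun i => (((y i).val : ℕ) : ZMod Lc))) ≠ y),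
      (‖(∑ t₁ : ImagTimeIdx M,
          sectorisedKernel Lf M β (trivialMultiplier Lf M) Gf 2 (![((0, σ), 0), ((0, σ), 1)] : Fin 2 → SectorLeg 1) ![of, (t₁, of.2 + y)] *
            Complex.exp (((matsubaraFreq β M n * (imagTime β M of.1 - imagTime β M t₁) : ℝ) : ℂ) * I))‖ +
      ‖(∑ t₁ : ImagTimeIdx M,
          sectorisedKernel Lf M β (trivialMultiplier Lf M) Gf 2 (![((0, σ), 0), ((0, σ), 1)] : Fin 2 → SectorLeg 1) ![of, (t₁, of.2 + -y)] *
            Complex.exp (((matsubaraFreq β M n * (imagTime β M of.1 - imagTime β M t₁) : ℝ) : ℂ) * I))‖) ≤ Dfar)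
    (q : Fin 2 → ℝ) :
    |(symInterp Lc (fun k => (selfEnergy Lc M β Gc (n, k) σ).re)).eval q -
        (symInterp Lf (fun k => (selfEnergy Lf M β Gf (n, k) σ).re)).eval q| ≤ imagTimeWeight β M * (Ddef + Dfar) := by
  have hε : 0 ≤ imagTimeWeight β M := imagTimeWeight_nonneg hβ.le M
  -- the coefficient-level door of …TwoVolumeSymInterp
  have h1 := abs_eval_symInterp_sub_le_pinned_add_far hL (fun k => (selfEnergy Lc M β Gc (n, k) σ).re)
    (fun k => (selfEnergy Lf M β Gf (n, k) σ).re) q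
  refine h1.trans ?_
  rw [mul_add]
  refine add_le_add ?_ ?_
  · -- the pinned coefficient defect through the centred lift
    refine le_trans (sum_le_sum fun ybar _ => ?_) (le_trans (mul_sum _ _ _).symm.le (mul_le_mul_of_nonneg_left hdef hε))
    rw [torusCosCoeff_re_selfEnergy_eq_row_of_rowInvariant hβ.ne' Gc n σ hrowc oc ybar,
      torusCosCoeff_re_selfEnergy_eq_row_of_rowInvariant hβ.ne' Gf n σ hrowf of (Torus.proj Lf (Torus.cRep ybar)), ← mul_sub, abs_mul,
      abs_of_nonneg hε, ← Complex.sub_re]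
    refine mul_le_mul_of_nonneg_left ((Complex.abs_re_le_norm _).trans ?_) hε
    rw [add_sub_add_comm]
    exact norm_add_le _ _
  · -- the far fine coefficients
    refine le_trans (sum_le_sum fun y _ => ?_) (le_trans (mul_sum _ _ _).symm.le (mul_le_mul_of_nonneg_left hfar hε))
    rw [torusCosCoeff_re_selfEnergy_eq_row_of_rowInvariant hβ.ne' Gf n σ hrowf of y, abs_mul, abs_of_nonneg hε]
    exact mul_le_mul_of_nonneg_left ((Complex.abs_re_le_norm _).trans (norm_add_le _ _)) hε

end TwoVolumes

/-! ## §3 The model at scale `n`: two volumes, two frames, the separated data `𝒱⁽ⁿ⁾[K] − 𝒩_K` -/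

section Model

variable {Lc Lf b M : ℕ} [NeZero Lc] [NeZero Lf] [NeZero M]

/-- **(D) OF THE SPLIT DOOR FROM THE DUAL-LATTICE TWO-LEG DEFECT**, every scale `n`, two frames.  Volumes `Lf = b·Lc`, common `M`, `0 < β`;
frames `K_c`, `K_f` under the degree guards `K_c.degree ≤ Lc/2`, `K_f.degree ≤ Lf/2` (`FrameOKDeg.degree_le_half`); the separated Grassmann data
`G_L := 𝒱_L⁽ⁿ⁾[K_L] − 𝒩_{K_L} = klEffectiveAction L M β U μ K_L klE0 n − counterQuadratic L M β K_L`; for the four reading strings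
(`ω ∈ {ω₀, −ω₀}`, `σ`): base-point independence of the phase-weighted rows of `W_σ(G_c)`, `W_σ(G_f)`, the row defect through the centred lift at the
pins `o_c`, `o_f` (`≤ Ddef`, both offset signs) and the far fine rows (`≤ Dfar`).  Then at every continuum point `q`
`|S_c(q) − S_f(q)| ≤ |K_c(q) − K_f(q)| + ε·(Ddef + Dfar)`, `S_L = symInterp L (klLocSelfEnergyRe L M β U μ K_L n)`, `ε = β/(2M)` — the explicit frame
term carries coefficient `1` (the frame vertex is reproduced exactly by the interpolant). -/
theorem abs_symInterp_locRe_sub_le_frame_add_dualDefect (hL : Lf = b * Lc) {β : ℝ} (hβ : 0 < β) (U μ : ℝ) {Kc Kf : TrigPolyC4v}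
    (hdegc : Kc.degree ≤ Lc / 2) (hdegf : Kf.degree ≤ Lf / 2) (n : ℕ) (oc : SpaceTimeIdx Lc M) (of : SpaceTimeIdx Lf M) {Ddef Dfar : ℝ}
    (hrowc : ∀ m ∈ ({omega0 M, (omega0 M).rev} : Finset (MatsubaraIdx M)), ∀ (σ : Fin 2) (x₀ x₀' : SpaceTimeIdx Lc M) (z : TorusSite 2 Lc),
      (∑ t₁ : ImagTimeIdx M,
        sectorisedKernel Lc M β (trivialMultiplier Lc M) (klEffectiveAction Lc M β U μ Kc klE0 n - counterQuadratic Lc M β Kc) 2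
            (![((0, σ), 0), ((0, σ), 1)] : Fin 2 → SectorLeg 1) ![x₀, (t₁, x₀.2 + z)] *
          Complex.exp (((matsubaraFreq β M m * (imagTime β M x₀.1 - imagTime β M t₁) : ℝ) : ℂ) * I)) =
      ∑ t₁ : ImagTimeIdx M,
        sectorisedKernel Lc M β (trivialMultiplier Lc M) (klEffectiveAction Lc M β U μ Kc klE0 n - counterQuadratic Lc M β Kc) 2
            (![((0, σ), 0), ((0, σ), 1)] : Fin 2 → SectorLeg 1) ![x₀', (t₁, x₀'.2 + z)] *
          Complex.exp (((matsubaraFreq β M m * (imagTime β M x₀'.1 - imagTime β M t₁) : ℝ) : ℂ) * I))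
    (hrowf : ∀ m ∈ ({omega0 M, (omega0 M).rev} : Finset (MatsubaraIdx M)), ∀ (σ : Fin 2) (x₀ x₀' : SpaceTimeIdx Lf M) (z : TorusSite 2 Lf),
      (∑ t₁ : ImagTimeIdx M,
        sectorisedKernel Lf M β (trivialMultiplier Lf M) (klEffectiveAction Lf M β U μ Kf klE0 n - counterQuadratic Lf M β Kf) 2
            (![((0, σ), 0), ((0, σ), 1)] : Fin 2 → SectorLeg 1) ![x₀, (t₁, x₀.2 + z)] *
          Complex.exp (((matsubaraFreq β M m * (imagTime β M x₀.1 - imagTime β M t₁) : ℝ) : ℂ) * I)) =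
      ∑ t₁ : ImagTimeIdx M,
        sectorisedKernel Lf M β (trivialMultiplier Lf M) (klEffectiveAction Lf M β U μ Kf klE0 n - counterQuadratic Lf M β Kf) 2
            (![((0, σ), 0), ((0, σ), 1)] : Fin 2 → SectorLeg 1) ![x₀', (t₁, x₀'.2 + z)] *
          Complex.exp (((matsubaraFreq β M m * (imagTime β M x₀'.1 - imagTime β M t₁) : ℝ) : ℂ) * I))
    (hdef : ∀ m ∈ ({omega0 M, (omega0 M).rev} : Finset (MatsubaraIdx M)), ∀ σ : Fin 2, ∑ ybar : TorusSite 2 Lc,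
      (‖(∑ t₁ : ImagTimeIdx M,
          sectorisedKernel Lc M β (trivialMultiplier Lc M) (klEffectiveAction Lc M β U μ Kc klE0 n - counterQuadratic Lc M β Kc) 2
              (![((0, σ), 0), ((0, σ), 1)] : Fin 2 → SectorLeg 1) ![oc, (t₁, oc.2 + ybar)] *
            Complex.exp (((matsubaraFreq β M m * (imagTime β M oc.1 - imagTime β M t₁) : ℝ) : ℂ) * I)) -
        (∑ t₁ : ImagTimeIdx M,
          sectorisedKernel Lf M β (trivialMultiplier Lf M) (klEffectiveAction Lf M β U μ Kf klE0 n - counterQuadratic Lf M β Kf) 2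
              (![((0, σ), 0), ((0, σ), 1)] : Fin 2 → SectorLeg 1) ![of, (t₁, of.2 + Torus.proj Lf (Torus.cRep ybar))] *
            Complex.exp (((matsubaraFreq β M m * (imagTime β M of.1 - imagTime β M t₁) : ℝ) : ℂ) * I))‖ +
      ‖(∑ t₁ : ImagTimeIdx M,
          sectorisedKernel Lc M β (trivialMultiplier Lc M) (klEffectiveAction Lc M β U μ Kc klE0 n - counterQuadratic Lc M β Kc) 2
              (![((0, σ), 0), ((0, σ), 1)] : Fin 2 → SectorLeg 1) ![oc, (t₁, oc.2 + -ybar)] *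
            Complex.exp (((matsubaraFreq β M m * (imagTime β M oc.1 - imagTime β M t₁) : ℝ) : ℂ) * I)) -
        (∑ t₁ : ImagTimeIdx M,
          sectorisedKernel Lf M β (trivialMultiplier Lf M) (klEffectiveAction Lf M β U μ Kf klE0 n - counterQuadratic Lf M β Kf) 2
              (![((0, σ), 0), ((0, σ), 1)] : Fin 2 → SectorLeg 1) ![of, (t₁, of.2 + -Torus.proj Lf (Torus.cRep ybar))] *
            Complex.exp (((matsubaraFreq β M m * (imagTime β M of.1 - imagTime β M t₁) : ℝ) : ℂ) * I))‖) ≤ Ddef)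
    (hfar : ∀ m ∈ ({omega0 M, (omega0 M).rev} : Finset (MatsubaraIdx M)), ∀ σ : Fin 2,
      ∑ y ∈ univ.filter (fun y : TorusSite 2 Lf => Torus.proj Lf (Torus.cRep (fun i => (((y i).val : ℕ) : ZMod Lc))) ≠ y),
      (‖(∑ t₁ : ImagTimeIdx M,
          sectorisedKernel Lf M β (trivialMultiplier Lf M) (klEffectiveAction Lf M β U μ Kf klE0 n - counterQuadratic Lf M β Kf) 2
              (![((0, σ), 0), ((0, σ), 1)] : Fin 2 → SectorLeg 1) ![of, (t₁, of.2 + y)] *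
            Complex.exp (((matsubaraFreq β M m * (imagTime β M of.1 - imagTime β M t₁) : ℝ) : ℂ) * I))‖ +
      ‖(∑ t₁ : ImagTimeIdx M,
          sectorisedKernel Lf M β (trivialMultiplier Lf M) (klEffectiveAction Lf M β U μ Kf klE0 n - counterQuadratic Lf M β Kf) 2
              (![((0, σ), 0), ((0, σ), 1)] : Fin 2 → SectorLeg 1) ![of, (t₁, of.2 + -y)] *
            Complex.exp (((matsubaraFreq β M m * (imagTime β M of.1 - imagTime β M t₁) : ℝ) : ℂ) * I))‖) ≤ Dfar)
    (q : Fin 2 → ℝ) :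
    |(symInterp Lc (klLocSelfEnergyRe Lc M β U μ Kc n)).eval q - (symInterp Lf (klLocSelfEnergyRe Lf M β U μ Kf n)).eval q| ≤
      |Kc.eval q - Kf.eval q| + imagTimeWeight β M * (Ddef + Dfar) := by
  set Gc := klEffectiveAction Lc M β U μ Kc klE0 n - counterQuadratic Lc M β Kc with hGc
  set Gf := klEffectiveAction Lf M β U μ Kf klE0 n - counterQuadratic Lf M β Kf with hGf
  have h0 : omega0 M ∈ ({omega0 M, (omega0 M).rev} : Finset (MatsubaraIdx M)) := by simp
  have h0' : (omega0 M).rev ∈ ({omega0 M, (omega0 M).rev} : Finset (MatsubaraIdx M)) := by simp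
  -- the reading = frame + interpolant of the separated data, at `q`
  have hsplit : ∀ (L : ℕ) [NeZero L] (K : TrigPolyC4v), K.degree ≤ L / 2 →
      (symInterp L (klLocSelfEnergyRe L M β U μ K n)).eval q =
        (symInterp L (fun p => klLocSelfEnergyRe L M β U μ K n p - K.eval (latticeMomentum L p))).eval q + K.eval q := by
    intro L _ K hdeg
    have h := congrFun (evalM_symInterp_eq_sep_add_frame (L := L) (M := M) hdeg β U μ n) (WithLp.toLp 2 q)
    simpa only [evalM_apply, WithLp.ofLp_toLp] using h
  -- the separated data are the localised data of `G_L`, written as `¼·(four strings)`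
  have hsep : ∀ (L : ℕ) [NeZero L] (K : TrigPolyC4v),
      (fun p => klLocSelfEnergyRe L M β U μ K n p - K.eval (latticeMomentum L p)) = fun p => (1 / 4 : ℝ) *
        ((((selfEnergy L M β (klEffectiveAction L M β U μ K klE0 n - counterQuadratic L M β K) (omega0 M, p) 0).re +
          (selfEnergy L M β (klEffectiveAction L M β U μ K klE0 n - counterQuadratic L M β K) ((omega0 M).rev, p) 0).re) +
         ((selfEnergy L M β (klEffectiveAction L M β U μ K klE0 n - counterQuadratic L M β K) (omega0 M, p) 1).re +
          (selfEnergy L M β (klEffectiveAction L M β U μ K klE0 n - counterQuadratic L M β K) ((omega0 M).rev, p) 1).re))) := by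
    intro L _ K
    funext p
    rw [klLocSelfEnergyRe_sub_frame_eq_locRe hβ.ne' U μ K n p, Fin.sum_univ_two]
    ring
  have heval : ∀ (L : ℕ) [NeZero L] (K : TrigPolyC4v),
      (symInterp L (fun p => klLocSelfEnergyRe L M β U μ K n p - K.eval (latticeMomentum L p))).eval q = (1 / 4 : ℝ) *
        ((((symInterp L (fun p => (selfEnergy L M β (klEffectiveAction L M β U μ K klE0 n - counterQuadratic L M β K) (omega0 M, p) 0).re)).eval q +
          (symInterp L (fun p => (selfEnergy L M β (klEffectiveAction L M β U μ K klE0 n - counterQuadratic L M β K) ((omega0 M).rev, p) 0).re)).eval q) +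
         ((symInterp L (fun p => (selfEnergy L M β (klEffectiveAction L M β U μ K klE0 n - counterQuadratic L M β K) (omega0 M, p) 1).re)).eval q +
          (symInterp L (fun p => (selfEnergy L M β (klEffectiveAction L M β U μ K klE0 n - counterQuadratic L M β K) ((omega0 M).rev, p) 1).re)).eval q))) := by
    intro L _ K
    rw [hsep L K, eval_symInterp_const_mul, eval_symInterp_add, eval_symInterp_add, eval_symInterp_add]
  -- the four strings, each through §2
  have hstr : ∀ m ∈ ({omega0 M, (omega0 M).rev} : Finset (MatsubaraIdx M)), ∀ σ : Fin 2,
      |(symInterp Lc (fun k => (selfEnergy Lc M β Gc (m, k) σ).re)).eval q -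
        (symInterp Lf (fun k => (selfEnergy Lf M β Gf (m, k) σ).re)).eval q| ≤ imagTimeWeight β M * (Ddef + Dfar) :=
    fun m hm σ => abs_eval_symInterp_re_selfEnergy_sub_le_dualDefect hL hβ Gc Gf m σ (hrowc m hm σ) (hrowf m hm σ) oc of
      (hdef m hm σ) (hfar m hm σ) q
  have h00 := hstr _ h0 0
  have h01 := hstr _ h0' 0
  have h10 := hstr _ h0 1
  have h11 := hstr _ h0' 1
  rw [hsplit Lc Kc hdegc, hsplit Lf Kf hdegf, heval Lc Kc, heval Lf Kf]
  rw [abs_sub_comm] at h00 h01 h10 h11 ⊢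
  have habs : ∀ (a₁ a₂ a₃ a₄ c₁ c₂ c₃ c₄ kc kf : ℝ),
      |(1 / 4 : ℝ) * ((c₁ + c₂) + (c₃ + c₄)) + kf - ((1 / 4 : ℝ) * ((a₁ + a₂) + (a₃ + a₄)) + kc)| ≤
        |kc - kf| + (1 / 4 : ℝ) * (|c₁ - a₁| + |c₂ - a₂| + |c₃ - a₃| + |c₄ - a₄|) := by
    intro a₁ a₂ a₃ a₄ c₁ c₂ c₃ c₄ kc kf
    have h : (1 / 4 : ℝ) * ((c₁ + c₂) + (c₃ + c₄)) + kf - ((1 / 4 : ℝ) * ((a₁ + a₂) + (a₃ + a₄)) + kc) =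
        (kf - kc) + (1 / 4 : ℝ) * ((c₁ - a₁) + (c₂ - a₂) + (c₃ - a₃) + (c₄ - a₄)) := by ring
    rw [h]
    refine (abs_add_le _ _).trans ?_
    rw [abs_sub_comm kf kc, abs_mul, abs_of_pos (by norm_num : (0 : ℝ) < 1 / 4)]
    gcongr
    exact (abs_add_le _ _).trans (add_le_add ((abs_add_le _ _).trans (add_le_add (abs_add_le _ _) le_rfl)) le_rfl)
  refine (habs _ _ _ _ _ _ _ _ _ _).trans ?_
  have hsum : (1 / 4 : ℝ) * (imagTimeWeight β M * (Ddef + Dfar) + imagTimeWeight β M * (Ddef + Dfar) +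
      imagTimeWeight β M * (Ddef + Dfar) + imagTimeWeight β M * (Ddef + Dfar)) = imagTimeWeight β M * (Ddef + Dfar) := by ring
  rw [← hsum]
  gcongr

end Model

end Summit.HubbardSuperconductivity.HubbardSuperconductivity.Theorems.TwoVolumeDefect

end
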